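import Summits.Ventures.CertifiedManyBodySolver.Observables.MeanFieldClassExclusionLaBox
import HarnessLib

/-!
# Ventures/CertifiedManyBodySolver — Observables/MeanFieldClassExclusionLaColumns.lean

HONEST FRAMING: first certified bounds; not a superconductivity verdict; every number certified or labelled float.
A competing-order EXCLUSION removes a named class of candidate ground states; it never says which order is present;
no phase sentence follows.

Cell `hubbard-tc` (MO-S3, D-0096), seat `hubbard-tc-mod-3` (G3), `prover-hubbard-tc-mod-3-g2-0`. The OTHER FILLING COLUMNS of
the La₂₋ₓSrₓCuO₄ S1 BOX OF RECORD #18, OBJECT E (`t′/t_eff ∈ [−0.30, −0.20]`, `U/t_eff ∈ [7.9, 14.7]`; TC-TABLE v0.7 §0): for every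
torus limit `ω` of unit `(rectN n L, S^z = 0)`-sector ground states of `hubbardTorusTT' L 1 t′ U`,

  `Re ω(n_{0↑} n_{0↓}) < (n/2)²`   (no ground state is a non-magnetic Hartree–Fock / singlet BCS state)

on  x = 0 (column M13, hole half): `n ∈ [99/100, 1]`, `t′ ∈ [−3/10, 0]`, every `U ≥ 7` (`laCol_x0_docc_lt_of`);
    x = 0.07 (M14): `n ∈ [91/100, 95/100]`, `t′ ∈ [−3/10, 0]`, every `U ≥ 7` (`laCol_x007_docc_lt_of`);
    x = 0.15 (M16): `n ∈ [83/100, 87/100]`, `t′ ∈ [−3/10, 0]`, every `U ≥ 7` (`laCol_x015_docc_lt_of`);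
    x = 0.22 (M17): `n ∈ [76/100, 4/5]`, `t′ ∈ [−3/10, −1/5]`, every `U ≥ 79/10` (`laCol_x022_docc_lt_of`)
(the x = ⅛ column M15 is `laBox_docc_lt_sq_half_density_of` of `MeanFieldClassExclusionLaBox.lean`; x = 0.30 (#50) does not close
with kernel-grade floors and stays cert-num, EXCLUSION-TABLE §B‴). UNBOUNDED IN `U`: the cap is transported in `U` at the query density
`n` AFTER the filling chord at `U = 8`, so the Hartree–Fock Lipschitz constant `(n/2)²` cancels against the class floor's `U(n/2)²` and only
the `U = 8` inequality `u₈ − ℓ < 8(n/2)²` (and `u₈ − ℓ < (n/2)²·U` below 8) remains (`doccN_lt_of_cap8`).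

Devices (all tree theorems; claim nodes #354 `cert_dbt299pair_allk`, #445 `cert_dbt329pair_allk`, #472 `cert_r472_pb2_tl_upper_n1_U8`
BY HYPOTHESIS): the strip cap `strip78_cap_of_anchor` and the cell-exact Fermi-sea floors (`fermiSeaCellRow_*`, `strip78_floor_between`)
at `n = 7/8`; the half-filling cap `laBox_halfFilling_cap_of` and the exact free value `laBox_free_halfFilling_cap` (`−16/π² < −1.6211`);
filling transport by convexity — vacuum chord below `7/8` (`lowBand_cap8`, `energyDensityTT'_le_vacuum_chord`), density chords to half
filling above (`energyDensityTT'_le_density_chord`, `energyDensityTT'_le_max_of_mem_Icc`), secant floors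
(`energyDensityTT'_ge_min_of_mem_Icc_left/right`); the docc `U`-chord tail `doccN_lt_of_cap_of_floor`. Margins of the linear checks:
`+0.38` (x = 0), `+0.22` (0.07), `+0.089` (0.15), `+0.084` (0.22) at the worst `(t′, U)` corner (exact decimal arithmetic).
WHAT THIS IS NOT: the particle side `n ∈ (1, 1.01]` of M13 (by particle–hole symmetry it is the mirrored box at `t′ > 0`, not
treated); the FM class; tight.

References: Koma–Tasaki 1994 §1 [KomaTasaki1994]; Bach–Lieb–Solovej 1994 eq. (2c.36) [BachLiebSolovej1994]; Lieb–Loss 1993 §8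
Thm 8.2 [LiebLoss1993]; Israel 1979 Thm I.3.4 [Israel1979]; Ruelle 1969 §3.3 [Ruelle1969].
-/

noncomputable section

namespace Summit.Ventures.CertifiedManyBodySolver.Observables

open Literature.MathematicalPhysics.QuantumLattice
open Literature.MathematicalPhysics.QuantumLattice.ThermodynamicLimit
open Summit.Ventures.CertifiedManyBodySolver.Certificates
open Matrix HubbardWave0 Literature.Probability.LatticeModels Filter Topology
open scoped ComplexOrder BigOperators

/-! ### §1 The tail with the cap taken at `U = 8` and transported at the query density -/

/-- **docc tail from a `U = 8` cap at density `n`.** If `e(1,t′,8,n) ≤ u₈`, `ℓ ≤ e(1,t′,0,n)`, and both `u₈ − ℓ < (n/2)²·U` and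
`u₈ − ℓ < 8(n/2)²`, then every torus-limit ground state at `(1, t′, U, n)` (`U > 0`, `0 ≤ n < 2`) has `Re ω(n_{0↑}n_{0↓}) < (n/2)²`:
below `U = 8` by monotonicity, above by the Hartree–Fock Lipschitz constant `(n/2)²` (`energyDensityTT'_ge_sub_mul_sq_U`), which
cancels against the target. [cite: KomaTasaki1994, §1] [cite: Israel1979, Thm. I.3.4] -/
theorem doccN_lt_of_cap8 {t' U n u8 ℓ : ℝ} (hU0 : 0 < U) (hn0 : 0 ≤ n) (hn2 : n < 2)
    (hcap8 : energyDensityTT' 1 t' 8 n ≤ u8) (hℓ : ℓ ≤ energyDensityTT' 1 t' 0 n)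
    (hlinU : u8 - ℓ < (n / 2) ^ 2 * U) (hlin8 : u8 - ℓ < 8 * (n / 2) ^ 2) :
    ∀ (ω : InfVolFermionState 2) (Ls : ℕ → ℕ) (ψ : ∀ L, Fock (Orb (FermionTorus 2 L))),
      Tendsto Ls atTop atTop →
      (∀ j, IsGroundStateInSector (hubbardTorusTT' (Ls j) 1 t' U) (rectN n (Ls j)) 0 (ψ (Ls j))) →
      (∀ j, star (ψ (Ls j)) ⬝ᵥ ψ (Ls j) = 1) → ω.IsTorusLimitOf ψ Ls →
      (ω.expect ({0} : Finset (Site 2))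
        (nAt 0 (Finset.mem_singleton_self 0) 0 * nAt 0 (Finset.mem_singleton_self 0) 1)).re < (n / 2) ^ 2 := by
  rcases le_total U 8 with hle | hle
  · have hm := energyDensityTT'_mono_U 1 t' hn0 hn2 hU0.le hle
    exact doccN_lt_of_cap_of_floor hU0 hn0 hn2 (hm.trans hcap8) hℓ hlinU
  · have hq := energyDensityTT'_ge_sub_mul_sq_U 1 t' hn0 hn2 (by norm_num : (0 : ℝ) ≤ 8) hle
    have hcap : energyDensityTT' 1 t' U n ≤ u8 + (U - 8) * (n / 2) ^ 2 := by linarith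
    refine doccN_lt_of_cap_of_floor hU0 hn0 hn2 hcap hℓ ?_
    have e : u8 + (U - 8) * (n / 2) ^ 2 - ℓ = (u8 - ℓ - 8 * (n / 2) ^ 2) + (n / 2) ^ 2 * U := by ring
    rw [e]
    linarith

/-- Elementary: two cap branches each below `X + ℓ` give `max a b − ℓ < X`. [folklore] -/
theorem max2_sub_lt {a b ℓ X : ℝ} (h1 : a < X + ℓ) (h2 : b < X + ℓ) : max a b - ℓ < X := by
  rw [sub_lt_iff_lt_add, max_lt_iff]
  exact ⟨h1, h2⟩

/-! ### §2 Filling transport at `U = 8` and `U = 0` -/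

/-- **Low-band cap at `U = 8`**: a cap `e(1,t′,8,7/8) ≤ S ≤ 0` gives `e(1,t′,8,n) ≤ (n₁/(7/8))·S` for every `n ∈ [n₁, 7/8]`,
`n₁ > 0` — the vacuum chord at `n` (convexity in the density, `e(0) = 0`) and `n/(7/8)·S ≤ n₁/(7/8)·S` for `S ≤ 0`. [cite: Ruelle1969, §3.3] -/
theorem lowBand_cap8 {t' S n₁ n : ℝ} (hS : energyDensityTT' 1 t' 8 (7 / 8) ≤ S) (hS0 : S ≤ 0) (hn₁ : 0 < n₁)
    (h1 : n₁ ≤ n) (h2 : n ≤ 7 / 8) :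
    energyDensityTT' 1 t' 8 n ≤ n₁ / (7 / 8) * S := by
  have hmono : n / (7 / 8) * S ≤ n₁ / (7 / 8) * S := by
    nlinarith [mul_nonneg (sub_nonneg.2 h1) (neg_nonneg.2 hS0)]
  rcases eq_or_lt_of_le h2 with h | h
  · rw [h] at hmono ⊢
    have h78 : (7 / 8 : ℝ) / (7 / 8) * S = S := by norm_num
    rw [h78] at hmono
    exact hS.trans hmono
  · have hv := energyDensityTT'_le_vacuum_chord 1 t' (by norm_num : (0 : ℝ) ≤ 8) (n := n) (n₂ := 7 / 8)
      (by linarith) h (by norm_num) hS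
    exact hv.trans hmono

/-- **Low-band free floor**: a floor `L ≤ e(1,t′,0,7/8)` with `L ≥ −1.6211` (the exact half-filled cap) gives `L ≤ e(1,t′,0,n)` for
every `n ∈ [n₁, 7/8]`, `n₁ ≥ 0` — the secant through `(7/8, L)` and `(1, −1.6211)` extrapolated to the left lies above `L`
(`energyDensityTT'_ge_min_of_mem_Icc_left`). [cite: Ruelle1969, §3.3] -/
theorem lowBand_floor {t' L n₁ n : ℝ} (hL : L ≤ energyDensityTT' 1 t' 0 (7 / 8)) (hLC : -1.6211 ≤ L) (hn₁ : 0 ≤ n₁)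
    (h1 : n₁ ≤ n) (h2 : n ≤ 7 / 8) :
    L ≤ energyDensityTT' 1 t' 0 n := by
  have h := energyDensityTT'_ge_min_of_mem_Icc_left 1 t' le_rfl (n₁ := n₁) (n₂ := 7 / 8) (n₃ := 1) hn₁
    (by norm_num) (by norm_num) hL (laBox_free_halfFilling_cap t') ⟨h1, h2⟩
  refine le_trans (le_min le_rfl ?_) h
  have hnn : 0 ≤ (L - -1.6211) * (7 / 8 - n₁) / (1 - 7 / 8) :=
    div_nonneg (mul_nonneg (by linarith) (by linarith)) (by norm_num)
  linarith

/-- **High-band free floor**: a floor `L ≤ e(1,t′,0,7/8)` with `L ≤ 0` gives `L + L·(n₂ − 7/8)/(7/8) ≤ e(1,t′,0,n)` for every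
`n ∈ [7/8, n₂]`, `n₂ < 2` — the vacuum secant extrapolated to the right (`energyDensityTT'_ge_min_of_mem_Icc_right`).
[cite: Ruelle1969, §3.3] -/
theorem highBand_floor {t' L n₂ n : ℝ} (hL : L ≤ energyDensityTT' 1 t' 0 (7 / 8)) (hL0 : L ≤ 0)
    (h1 : 7 / 8 ≤ n) (h2 : n ≤ n₂) (hn₂ : n₂ < 2) :
    L + L * (n₂ - 7 / 8) / (7 / 8) ≤ energyDensityTT' 1 t' 0 n := by
  have h := energyDensityTT'_ge_min_of_mem_Icc_right 1 t' le_rfl (n₀ := 0) (n₁ := 7 / 8) (n₂ := n₂)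
    (by norm_num) (by norm_num) hn₂ (energyDensityTT'_density_zero_le 1 t' le_rfl) hL ⟨h1, h2⟩
  refine le_trans (le_min ?_ ?_) h
  · have hnn : L * (n₂ - 7 / 8) / (7 / 8) ≤ 0 :=
      by nlinarith [mul_nonneg (neg_nonneg.2 hL0) (by linarith : (0 : ℝ) ≤ n₂ - 7 / 8)]
    linarith
  · have e : L + (L - 0) * (n₂ - 7 / 8) / (7 / 8 - 0) = L + L * (n₂ - 7 / 8) / (7 / 8) := by ring
    rw [e]

/-- **Column x = 0 cap at `U = 8`** (`n ∈ [99/100, 1]`): `e(1,t′,8,n) ≤ max ((2/25)·S + (23/25)·C) C` from the caps `S` at `7/8`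
and `C` at half filling (density chord at `99/100`, convexity). [cite: Ruelle1969, §3.3] -/
theorem laCol_x0_cap8 {t' S C n : ℝ} (hS : energyDensityTT' 1 t' 8 (7 / 8) ≤ S) (hC : energyDensityTT' 1 t' 8 1 ≤ C)
    (h1 : 99 / 100 ≤ n) (h2 : n ≤ 1) :
    energyDensityTT' 1 t' 8 n ≤ max (2 / 25 * S + 23 / 25 * C) C := by
  have h99 := energyDensityTT'_le_density_chord 1 t' (by norm_num : (0 : ℝ) ≤ 8) (n₁ := 7 / 8) (n := 99 / 100)
    (n₂ := 1) (by norm_num) (by norm_num) (by norm_num) (by norm_num) hS hC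
  have e99 : ((1 - 99 / 100) * S + (99 / 100 - 7 / 8) * C) / (1 - 7 / 8) = (2 / 25 : ℝ) * S + 23 / 25 * C := by ring
  rw [e99] at h99
  exact energyDensityTT'_le_max_of_mem_Icc 1 t' (by norm_num : (0 : ℝ) ≤ 8) (m₁ := 99 / 100) (m₂ := 1)
    (by norm_num) (by norm_num) h99 hC ⟨h1, h2⟩

/-- **Column x = 0.07 cap at `U = 8`** (`n ∈ [91/100, 95/100]`): `e(1,t′,8,n) ≤ max ((18/25)·S + (7/25)·C) ((2/5)·S + (3/5)·C)`.
[cite: Ruelle1969, §3.3] -/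
theorem laCol_x007_cap8 {t' S C n : ℝ} (hS : energyDensityTT' 1 t' 8 (7 / 8) ≤ S) (hC : energyDensityTT' 1 t' 8 1 ≤ C)
    (h1 : 91 / 100 ≤ n) (h2 : n ≤ 95 / 100) :
    energyDensityTT' 1 t' 8 n ≤ max (18 / 25 * S + 7 / 25 * C) (2 / 5 * S + 3 / 5 * C) := by
  have h91 := energyDensityTT'_le_density_chord 1 t' (by norm_num : (0 : ℝ) ≤ 8) (n₁ := 7 / 8) (n := 91 / 100)
    (n₂ := 1) (by norm_num) (by norm_num) (by norm_num) (by norm_num) hS hC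
  have h95 := energyDensityTT'_le_density_chord 1 t' (by norm_num : (0 : ℝ) ≤ 8) (n₁ := 7 / 8) (n := 95 / 100)
    (n₂ := 1) (by norm_num) (by norm_num) (by norm_num) (by norm_num) hS hC
  have e91 : ((1 - 91 / 100) * S + (91 / 100 - 7 / 8) * C) / (1 - 7 / 8) = (18 / 25 : ℝ) * S + 7 / 25 * C := by ring
  have e95 : ((1 - 95 / 100) * S + (95 / 100 - 7 / 8) * C) / (1 - 7 / 8) = (2 / 5 : ℝ) * S + 3 / 5 * C := by ring
  rw [e91] at h91
  rw [e95] at h95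
  exact energyDensityTT'_le_max_of_mem_Icc 1 t' (by norm_num : (0 : ℝ) ≤ 8) (m₁ := 91 / 100) (m₂ := 95 / 100)
    (by norm_num) (by norm_num) h91 h95 ⟨h1, h2⟩

/-! ### §3 The four column words -/

section Columns

variable (h354 : cert_dbt299pair_allk) (h445 : cert_dbt329pair_allk) (h472 : cert_r472_pb2_tl_upper_n1_U8)
include h354 h445 h472

/-- The three caps at `U = 8` in decimal form: anchor `0`, anchor `−1/4` (with the `t′`-transport term) and half filling.
[cite: Ruelle1969, §3.3] -/
theorem laCol_caps8 (t' : ℝ) :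
    energyDensityTT' 1 t' 8 (7 / 8) ≤ -0.7059400775 + 1.6212 * |t' - 0| ∧
      energyDensityTT' 1 t' 8 (7 / 8) ≤ -0.6866417849 + 1.6212 * |t' - -1 / 4| ∧
      energyDensityTT' 1 t' 8 1 ≤ -0.5087724429 := by
  have h8 : (0 : ℝ) ≤ 8 := by norm_num
  have hA := strip78_cap_of_anchor (m3_tp0_cap_decimal_of h354) t' h8
  have hB := strip78_cap_of_anchor (m3_tpm1o4_cap_decimal_of h445) t' h8
  have hC := laBox_halfFilling_cap_of h472 t' h8
  rw [sub_self, max_self, mul_zero, add_zero] at hA hB hC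
  exact ⟨hA, hB, hC⟩

/-- **Column x = 0 (M13, hole half)**: for `t′ ∈ [−3/10, 0]`, `U ≥ 7`, `n ∈ [99/100, 1]`, every GS torus limit has
`Re ω(n_{0↑}n_{0↓}) < (n/2)²`. [cite: KomaTasaki1994, §1] [cite: BachLiebSolovej1994, eq. (2c.36)] [cite: LiebLoss1993, §8, Theorem 8.2] -/
theorem laCol_x0_docc_lt_of {t' U n : ℝ} (ht1 : -3 / 10 ≤ t') (ht0 : t' ≤ 0) (hU7 : 7 ≤ U)
    (hn1 : 99 / 100 ≤ n) (hn2 : n ≤ 1) :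
    ∀ (ω : InfVolFermionState 2) (Ls : ℕ → ℕ) (ψ : ∀ L, Fock (Orb (FermionTorus 2 L))),
      Tendsto Ls atTop atTop →
      (∀ j, IsGroundStateInSector (hubbardTorusTT' (Ls j) 1 t' U) (rectN n (Ls j)) 0 (ψ (Ls j))) →
      (∀ j, star (ψ (Ls j)) ⬝ᵥ ψ (Ls j) = 1) → ω.IsTorusLimitOf ψ Ls →
      (ω.expect ({0} : Finset (Site 2))
        (nAt 0 (Finset.mem_singleton_self 0) 0 * nAt 0 (Finset.mem_singleton_self 0) 1)).re < (n / 2) ^ 2 := by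
  have hU0 : (0 : ℝ) < U := by linarith
  have hn0 : (0 : ℝ) ≤ n := by linarith
  have hn2' : n < 2 := by linarith
  have hc : (9801 / 40000 : ℝ) ≤ (n / 2) ^ 2 := by nlinarith
  have hcu : (9801 / 40000 : ℝ) * U ≤ (n / 2) ^ 2 * U := mul_le_mul_of_nonneg_right hc hU0.le
  obtain ⟨hA, hB, hC⟩ := laCol_caps8 h354 h445 h472 t'
  rw [sub_zero, abs_of_nonpos ht0] at hA
  rw [show t' - -1 / 4 = t' + 1 / 4 by ring] at hB
  have r30 := fermiSeaCellRow_tPrime_neg_three_div_ten_density_seven_div_eight (U := 0) le_rfl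
  have r25 := fermiSeaCellRow_tPrime_neg_one_div_four_density_seven_div_eight (U := 0) le_rfl
  have r20 := fermiSeaCellRow_tPrime_neg_one_div_five_density_seven_div_eight (U := 0) le_rfl
  have r10 := fermiSeaCellRow_tPrime_neg_one_div_ten_density_seven_div_eight (U := 0) le_rfl
  have r00 := fermiSeaCellRow_tPrime_zero_density_seven_div_eight (U := 0) le_rfl
  rcases le_or_gt t' (-1 / 4) with hpA | hpA
  · have hfl := strip78_floor_between (s := t') le_rfl (by norm_num : (-3 / 10 : ℝ) ≤ -1 / 4) r30 r25 ht1 hpA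
    have hL : (-1.5633688449 : ℝ) ≤ energyDensityTT' 1 t' 0 (7 / 8) := le_trans (le_min (by norm_num) le_rfl) hfl
    have hℓ := highBand_floor hL (by norm_num) (by linarith) hn2 (by norm_num)
    rw [abs_of_nonpos (by linarith : t' + 1 / 4 ≤ 0)] at hB
    exact doccN_lt_of_cap8 hU0 hn0 hn2' (laCol_x0_cap8 hB hC hn1 hn2) hℓ
      (max2_sub_lt (by linarith) (by linarith)) (max2_sub_lt (by linarith) (by linarith))
  rw [abs_of_nonneg (by linarith : 0 ≤ t' + 1 / 4)] at hB
  rcases le_or_gt t' (-1 / 5) with hpB | hpB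
  · have hfl := strip78_floor_between (s := t') le_rfl (by norm_num : (-1 / 4 : ℝ) ≤ -1 / 5) r25 r20 hpA.le hpB
    have hL : (-1.5668014377 : ℝ) ≤ energyDensityTT' 1 t' 0 (7 / 8) := le_trans (le_min (by norm_num) le_rfl) hfl
    have hℓ := highBand_floor hL (by norm_num) (by linarith) hn2 (by norm_num)
    exact doccN_lt_of_cap8 hU0 hn0 hn2' (laCol_x0_cap8 hB hC hn1 hn2) hℓ
      (max2_sub_lt (by linarith) (by linarith)) (max2_sub_lt (by linarith) (by linarith))
  rcases le_or_gt t' (-13 / 100) with hpC | hpC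
  · have hfl := strip78_floor_between (s := t') le_rfl (by norm_num : (-1 / 5 : ℝ) ≤ -1 / 10) r20 r10 hpB.le (by linarith)
    have hL : (-1.5831346202 : ℝ) ≤ energyDensityTT' 1 t' 0 (7 / 8) := le_trans (le_min (by norm_num) le_rfl) hfl
    have hℓ := highBand_floor hL (by norm_num) (by linarith) hn2 (by norm_num)
    exact doccN_lt_of_cap8 hU0 hn0 hn2' (laCol_x0_cap8 hB hC hn1 hn2) hℓ
      (max2_sub_lt (by linarith) (by linarith)) (max2_sub_lt (by linarith) (by linarith))
  rcases le_or_gt t' (-1 / 10) with hpD | hpD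
  · have hfl := strip78_floor_between (s := t') le_rfl (by norm_num : (-1 / 5 : ℝ) ≤ -1 / 10) r20 r10 hpB.le hpD
    have hL : (-1.5831346202 : ℝ) ≤ energyDensityTT' 1 t' 0 (7 / 8) := le_trans (le_min (by norm_num) le_rfl) hfl
    have hℓ := highBand_floor hL (by norm_num) (by linarith) hn2 (by norm_num)
    exact doccN_lt_of_cap8 hU0 hn0 hn2' (laCol_x0_cap8 hA hC hn1 hn2) hℓ
      (max2_sub_lt (by linarith) (by linarith)) (max2_sub_lt (by linarith) (by linarith))
  · have hfl := strip78_floor_between (s := t') le_rfl (by norm_num : (-1 / 10 : ℝ) ≤ 0) r10 r00 hpD.le ht0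
    have hL : (-1.6103642235 : ℝ) ≤ energyDensityTT' 1 t' 0 (7 / 8) := le_trans (le_min (by norm_num) le_rfl) hfl
    have hℓ := highBand_floor hL (by norm_num) (by linarith) hn2 (by norm_num)
    exact doccN_lt_of_cap8 hU0 hn0 hn2' (laCol_x0_cap8 hA hC hn1 hn2) hℓ
      (max2_sub_lt (by linarith) (by linarith)) (max2_sub_lt (by linarith) (by linarith))

/-- **Column x = 0.07 (M14)**: for `t′ ∈ [−3/10, 0]`, `U ≥ 7`, `n ∈ [91/100, 95/100]`, every GS torus limit has
`Re ω(n_{0↑}n_{0↓}) < (n/2)²`. [cite: KomaTasaki1994, §1] [cite: BachLiebSolovej1994, eq. (2c.36)] [cite: LiebLoss1993, §8, Theorem 8.2] -/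
theorem laCol_x007_docc_lt_of {t' U n : ℝ} (ht1 : -3 / 10 ≤ t') (ht0 : t' ≤ 0) (hU7 : 7 ≤ U)
    (hn1 : 91 / 100 ≤ n) (hn2 : n ≤ 95 / 100) :
    ∀ (ω : InfVolFermionState 2) (Ls : ℕ → ℕ) (ψ : ∀ L, Fock (Orb (FermionTorus 2 L))),
      Tendsto Ls atTop atTop →
      (∀ j, IsGroundStateInSector (hubbardTorusTT' (Ls j) 1 t' U) (rectN n (Ls j)) 0 (ψ (Ls j))) →
      (∀ j, star (ψ (Ls j)) ⬝ᵥ ψ (Ls j) = 1) → ω.IsTorusLimitOf ψ Ls →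
      (ω.expect ({0} : Finset (Site 2))
        (nAt 0 (Finset.mem_singleton_self 0) 0 * nAt 0 (Finset.mem_singleton_self 0) 1)).re < (n / 2) ^ 2 := by
  have hU0 : (0 : ℝ) < U := by linarith
  have hn0 : (0 : ℝ) ≤ n := by linarith
  have hn2' : n < 2 := by linarith
  have hc : (8281 / 40000 : ℝ) ≤ (n / 2) ^ 2 := by nlinarith
  have hcu : (8281 / 40000 : ℝ) * U ≤ (n / 2) ^ 2 * U := mul_le_mul_of_nonneg_right hc hU0.le
  obtain ⟨hA, hB, hC⟩ := laCol_caps8 h354 h445 h472 t'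
  rw [sub_zero, abs_of_nonpos ht0] at hA
  rw [show t' - -1 / 4 = t' + 1 / 4 by ring] at hB
  have r30 := fermiSeaCellRow_tPrime_neg_three_div_ten_density_seven_div_eight (U := 0) le_rfl
  have r25 := fermiSeaCellRow_tPrime_neg_one_div_four_density_seven_div_eight (U := 0) le_rfl
  have r20 := fermiSeaCellRow_tPrime_neg_one_div_five_density_seven_div_eight (U := 0) le_rfl
  have r10 := fermiSeaCellRow_tPrime_neg_one_div_ten_density_seven_div_eight (U := 0) le_rfl
  have r00 := fermiSeaCellRow_tPrime_zero_density_seven_div_eight (U := 0) le_rfl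
  rcases le_or_gt t' (-1 / 4) with hpA | hpA
  · have hfl := strip78_floor_between (s := t') le_rfl (by norm_num : (-3 / 10 : ℝ) ≤ -1 / 4) r30 r25 ht1 hpA
    have hL : (-1.5633688449 : ℝ) ≤ energyDensityTT' 1 t' 0 (7 / 8) := le_trans (le_min (by norm_num) le_rfl) hfl
    have hℓ := highBand_floor hL (by norm_num) (by linarith) hn2 (by norm_num)
    rw [abs_of_nonpos (by linarith : t' + 1 / 4 ≤ 0)] at hB
    exact doccN_lt_of_cap8 hU0 hn0 hn2' (laCol_x007_cap8 hB hC hn1 hn2) hℓ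
      (max2_sub_lt (by linarith) (by linarith)) (max2_sub_lt (by linarith) (by linarith))
  rw [abs_of_nonneg (by linarith : 0 ≤ t' + 1 / 4)] at hB
  rcases le_or_gt t' (-1 / 5) with hpB | hpB
  · have hfl := strip78_floor_between (s := t') le_rfl (by norm_num : (-1 / 4 : ℝ) ≤ -1 / 5) r25 r20 hpA.le hpB
    have hL : (-1.5668014377 : ℝ) ≤ energyDensityTT' 1 t' 0 (7 / 8) := le_trans (le_min (by norm_num) le_rfl) hfl
    have hℓ := highBand_floor hL (by norm_num) (by linarith) hn2 (by norm_num)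
    exact doccN_lt_of_cap8 hU0 hn0 hn2' (laCol_x007_cap8 hB hC hn1 hn2) hℓ
      (max2_sub_lt (by linarith) (by linarith)) (max2_sub_lt (by linarith) (by linarith))
  rcases le_or_gt t' (-13 / 100) with hpC | hpC
  · have hfl := strip78_floor_between (s := t') le_rfl (by norm_num : (-1 / 5 : ℝ) ≤ -1 / 10) r20 r10 hpB.le (by linarith)
    have hL : (-1.5831346202 : ℝ) ≤ energyDensityTT' 1 t' 0 (7 / 8) := le_trans (le_min (by norm_num) le_rfl) hfl
    have hℓ := highBand_floor hL (by norm_num) (by linarith) hn2 (by norm_num)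
    exact doccN_lt_of_cap8 hU0 hn0 hn2' (laCol_x007_cap8 hB hC hn1 hn2) hℓ
      (max2_sub_lt (by linarith) (by linarith)) (max2_sub_lt (by linarith) (by linarith))
  rcases le_or_gt t' (-1 / 10) with hpD | hpD
  · have hfl := strip78_floor_between (s := t') le_rfl (by norm_num : (-1 / 5 : ℝ) ≤ -1 / 10) r20 r10 hpB.le hpD
    have hL : (-1.5831346202 : ℝ) ≤ energyDensityTT' 1 t' 0 (7 / 8) := le_trans (le_min (by norm_num) le_rfl) hfl
    have hℓ := highBand_floor hL (by norm_num) (by linarith) hn2 (by norm_num)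
    exact doccN_lt_of_cap8 hU0 hn0 hn2' (laCol_x007_cap8 hA hC hn1 hn2) hℓ
      (max2_sub_lt (by linarith) (by linarith)) (max2_sub_lt (by linarith) (by linarith))
  · have hfl := strip78_floor_between (s := t') le_rfl (by norm_num : (-1 / 10 : ℝ) ≤ 0) r10 r00 hpD.le ht0
    have hL : (-1.6103642235 : ℝ) ≤ energyDensityTT' 1 t' 0 (7 / 8) := le_trans (le_min (by norm_num) le_rfl) hfl
    have hℓ := highBand_floor hL (by norm_num) (by linarith) hn2 (by norm_num)
    exact doccN_lt_of_cap8 hU0 hn0 hn2' (laCol_x007_cap8 hA hC hn1 hn2) hℓ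
      (max2_sub_lt (by linarith) (by linarith)) (max2_sub_lt (by linarith) (by linarith))

/-- **Column x = 0.15 (M16)**: for `t′ ∈ [−3/10, 0]`, `U ≥ 7`, `n ∈ [83/100, 87/100]`, every GS torus limit has
`Re ω(n_{0↑}n_{0↓}) < (n/2)²`. [cite: KomaTasaki1994, §1] [cite: BachLiebSolovej1994, eq. (2c.36)] [cite: LiebLoss1993, §8, Theorem 8.2] -/
theorem laCol_x015_docc_lt_of {t' U n : ℝ} (ht1 : -3 / 10 ≤ t') (ht0 : t' ≤ 0) (hU7 : 7 ≤ U)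
    (hn1 : 83 / 100 ≤ n) (hn2 : n ≤ 87 / 100) :
    ∀ (ω : InfVolFermionState 2) (Ls : ℕ → ℕ) (ψ : ∀ L, Fock (Orb (FermionTorus 2 L))),
      Tendsto Ls atTop atTop →
      (∀ j, IsGroundStateInSector (hubbardTorusTT' (Ls j) 1 t' U) (rectN n (Ls j)) 0 (ψ (Ls j))) →
      (∀ j, star (ψ (Ls j)) ⬝ᵥ ψ (Ls j) = 1) → ω.IsTorusLimitOf ψ Ls →
      (ω.expect ({0} : Finset (Site 2))
        (nAt 0 (Finset.mem_singleton_self 0) 0 * nAt 0 (Finset.mem_singleton_self 0) 1)).re < (n / 2) ^ 2 := by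
  have hU0 : (0 : ℝ) < U := by linarith
  have hn0 : (0 : ℝ) ≤ n := by linarith
  have hn2' : n < 2 := by linarith
  have h78 : n ≤ 7 / 8 := by linarith
  have hc : (6889 / 40000 : ℝ) ≤ (n / 2) ^ 2 := by nlinarith
  have hcu : (6889 / 40000 : ℝ) * U ≤ (n / 2) ^ 2 * U := mul_le_mul_of_nonneg_right hc hU0.le
  obtain ⟨hA, hB, -⟩ := laCol_caps8 h354 h445 h472 t'
  rw [sub_zero, abs_of_nonpos ht0] at hA
  rw [show t' - -1 / 4 = t' + 1 / 4 by ring] at hB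
  have r30 := fermiSeaCellRow_tPrime_neg_three_div_ten_density_seven_div_eight (U := 0) le_rfl
  have r25 := fermiSeaCellRow_tPrime_neg_one_div_four_density_seven_div_eight (U := 0) le_rfl
  have r20 := fermiSeaCellRow_tPrime_neg_one_div_five_density_seven_div_eight (U := 0) le_rfl
  have r10 := fermiSeaCellRow_tPrime_neg_one_div_ten_density_seven_div_eight (U := 0) le_rfl
  have r00 := fermiSeaCellRow_tPrime_zero_density_seven_div_eight (U := 0) le_rfl
  have hn₁ : (0 : ℝ) < 83 / 100 := by norm_num
  rcases le_or_gt t' (-1 / 4) with hpA | hpA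
  · have hfl := strip78_floor_between (s := t') le_rfl (by norm_num : (-3 / 10 : ℝ) ≤ -1 / 4) r30 r25 ht1 hpA
    have hL : (-1.5633688449 : ℝ) ≤ energyDensityTT' 1 t' 0 (7 / 8) := le_trans (le_min (by norm_num) le_rfl) hfl
    have hℓ := lowBand_floor hL (by norm_num) hn₁.le hn1 h78
    rw [abs_of_nonpos (by linarith : t' + 1 / 4 ≤ 0)] at hB
    exact doccN_lt_of_cap8 hU0 hn0 hn2' (lowBand_cap8 hB (by linarith) hn₁ hn1 h78) hℓ (by linarith) (by linarith)
  rw [abs_of_nonneg (by linarith : 0 ≤ t' + 1 / 4)] at hB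
  rcases le_or_gt t' (-1 / 5) with hpB | hpB
  · have hfl := strip78_floor_between (s := t') le_rfl (by norm_num : (-1 / 4 : ℝ) ≤ -1 / 5) r25 r20 hpA.le hpB
    have hL : (-1.5668014377 : ℝ) ≤ energyDensityTT' 1 t' 0 (7 / 8) := le_trans (le_min (by norm_num) le_rfl) hfl
    have hℓ := lowBand_floor hL (by norm_num) hn₁.le hn1 h78
    exact doccN_lt_of_cap8 hU0 hn0 hn2' (lowBand_cap8 hB (by linarith) hn₁ hn1 h78) hℓ (by linarith) (by linarith)
  rcases le_or_gt t' (-13 / 100) with hpC | hpC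
  · have hfl := strip78_floor_between (s := t') le_rfl (by norm_num : (-1 / 5 : ℝ) ≤ -1 / 10) r20 r10 hpB.le (by linarith)
    have hL : (-1.5831346202 : ℝ) ≤ energyDensityTT' 1 t' 0 (7 / 8) := le_trans (le_min (by norm_num) le_rfl) hfl
    have hℓ := lowBand_floor hL (by norm_num) hn₁.le hn1 h78
    exact doccN_lt_of_cap8 hU0 hn0 hn2' (lowBand_cap8 hB (by linarith) hn₁ hn1 h78) hℓ (by linarith) (by linarith)
  rcases le_or_gt t' (-1 / 10) with hpD | hpD
  · have hfl := strip78_floor_between (s := t') le_rfl (by norm_num : (-1 / 5 : ℝ) ≤ -1 / 10) r20 r10 hpB.le hpD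
    have hL : (-1.5831346202 : ℝ) ≤ energyDensityTT' 1 t' 0 (7 / 8) := le_trans (le_min (by norm_num) le_rfl) hfl
    have hℓ := lowBand_floor hL (by norm_num) hn₁.le hn1 h78
    exact doccN_lt_of_cap8 hU0 hn0 hn2' (lowBand_cap8 hA (by linarith) hn₁ hn1 h78) hℓ (by linarith) (by linarith)
  · have hfl := strip78_floor_between (s := t') le_rfl (by norm_num : (-1 / 10 : ℝ) ≤ 0) r10 r00 hpD.le ht0
    have hL : (-1.6103642235 : ℝ) ≤ energyDensityTT' 1 t' 0 (7 / 8) := le_trans (le_min (by norm_num) le_rfl) hfl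
    have hℓ := lowBand_floor hL (by norm_num) hn₁.le hn1 h78
    exact doccN_lt_of_cap8 hU0 hn0 hn2' (lowBand_cap8 hA (by linarith) hn₁ hn1 h78) hℓ (by linarith) (by linarith)

/-- **Column x = 0.22 (M17), on the object-E strip**: for `t′ ∈ [−3/10, −1/5]`, `U ≥ 79/10`, `n ∈ [76/100, 4/5]`, every GS torus
limit has `Re ω(n_{0↑}n_{0↓}) < (n/2)²`. [cite: KomaTasaki1994, §1] [cite: BachLiebSolovej1994, eq. (2c.36)] [cite: LiebLoss1993, §8, Theorem 8.2] -/
theorem laCol_x022_docc_lt_of {t' U n : ℝ} (ht1 : -3 / 10 ≤ t') (ht0 : t' ≤ -1 / 5) (hU79 : 79 / 10 ≤ U)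
    (hn1 : 76 / 100 ≤ n) (hn2 : n ≤ 4 / 5) :
    ∀ (ω : InfVolFermionState 2) (Ls : ℕ → ℕ) (ψ : ∀ L, Fock (Orb (FermionTorus 2 L))),
      Tendsto Ls atTop atTop →
      (∀ j, IsGroundStateInSector (hubbardTorusTT' (Ls j) 1 t' U) (rectN n (Ls j)) 0 (ψ (Ls j))) →
      (∀ j, star (ψ (Ls j)) ⬝ᵥ ψ (Ls j) = 1) → ω.IsTorusLimitOf ψ Ls →
      (ω.expect ({0} : Finset (Site 2))
        (nAt 0 (Finset.mem_singleton_self 0) 0 * nAt 0 (Finset.mem_singleton_self 0) 1)).re < (n / 2) ^ 2 := by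
  have hU0 : (0 : ℝ) < U := by linarith
  have hn0 : (0 : ℝ) ≤ n := by linarith
  have hn2' : n < 2 := by linarith
  have h78 : n ≤ 7 / 8 := by linarith
  have hc : (361 / 2500 : ℝ) ≤ (n / 2) ^ 2 := by nlinarith
  have hcu : (361 / 2500 : ℝ) * U ≤ (n / 2) ^ 2 * U := mul_le_mul_of_nonneg_right hc hU0.le
  obtain ⟨-, hB, -⟩ := laCol_caps8 h354 h445 h472 t'
  rw [show t' - -1 / 4 = t' + 1 / 4 by ring] at hB
  have r30 := fermiSeaCellRow_tPrime_neg_three_div_ten_density_seven_div_eight (U := 0) le_rfl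
  have r25 := fermiSeaCellRow_tPrime_neg_one_div_four_density_seven_div_eight (U := 0) le_rfl
  have r20 := fermiSeaCellRow_tPrime_neg_one_div_five_density_seven_div_eight (U := 0) le_rfl
  have hn₁ : (0 : ℝ) < 76 / 100 := by norm_num
  rcases le_or_gt t' (-1 / 4) with hpA | hpA
  · have hfl := strip78_floor_between (s := t') le_rfl (by norm_num : (-3 / 10 : ℝ) ≤ -1 / 4) r30 r25 ht1 hpA
    have hL : (-1.5633688449 : ℝ) ≤ energyDensityTT' 1 t' 0 (7 / 8) := le_trans (le_min (by norm_num) le_rfl) hfl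
    have hℓ := lowBand_floor hL (by norm_num) hn₁.le hn1 h78
    rw [abs_of_nonpos (by linarith : t' + 1 / 4 ≤ 0)] at hB
    exact doccN_lt_of_cap8 hU0 hn0 hn2' (lowBand_cap8 hB (by linarith) hn₁ hn1 h78) hℓ (by linarith) (by linarith)
  · rw [abs_of_nonneg (by linarith : 0 ≤ t' + 1 / 4)] at hB
    have hfl := strip78_floor_between (s := t') le_rfl (by norm_num : (-1 / 4 : ℝ) ≤ -1 / 5) r25 r20 hpA.le ht0
    have hL : (-1.5668014377 : ℝ) ≤ energyDensityTT' 1 t' 0 (7 / 8) := le_trans (le_min (by norm_num) le_rfl) hfl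
    have hℓ := lowBand_floor hL (by norm_num) hn₁.le hn1 h78
    exact doccN_lt_of_cap8 hU0 hn0 hn2' (lowBand_cap8 hB (by linarith) hn₁ hn1 h78) hℓ (by linarith) (by linarith)

end Columns

end Summit.Ventures.CertifiedManyBodySolver.Observables

end
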